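import Summits.MatrixMultiplication.MatrixMultiplication.Theses.AutomaticSTPPDesigns
import Summits.MatrixMultiplication.MatrixMultiplication.Theorems.AutomaticSTPPDesignsSmallScalesSufficeLetters

/-!
# MatrixMultiplication / AutomaticSTPPDesigns — `SmallScalesSuffice`
# (stmt-MatrixMultiplication-7360)

Route `AutomaticSTPPDesigns`, support item `SmallScalesSuffice` ("the verification engine as a
theorem"): for three DFAs `MA, MB, MC` over the alphabet `ι × Fin p` (`p ≥ 2`) with state sets
`σA, σB, σC`, if the induced digit-block family is an (additive) STPP family in `ZMod (p ^ k)` for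
every `k ≤ 14 (|σA| |σB| |σC|)²`, then it is one at every scale `k`.

Proof (pumping down). A violation of either clause of `AddSimultaneousTPP` at scale `k` is a list of
`k` letters, each letter carrying three index symbols and six base-`p` digits (least significant
first). Reading such a list left to right, the data
`(six DFA states, carry of the signed digit sum ∈ [-2, 2], flag "an inequality has been seen")`
takes at most `10 (|σA| |σB| |σC|)²` values, so for `k ≥ 10 (|σA| |σB| |σC|)²` two of the `k + 1`
prefixes carry the same data and deleting the segment between them leaves a violation at a smaller
scale (`smallScales_shorten`, file `…SmallScalesSufficePumping`); the translation between failures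
of `AddSimultaneousTPP` and violating lists is `smallScales_extract` / `smallScales_realize` (file
`…SmallScalesSufficeLetters`). Strong induction on `k` finishes; the bound `14 (|σA| |σB| |σC|)²` of
the statement exceeds the `10 (|σA| |σB| |σC|)²` needed.
-/

-- the tree's namespace `Summit.MatrixMultiplication.MatrixMultiplication.…` repeats a component by
-- design
set_option linter.dupNamespace false

namespace Summit.MatrixMultiplication.MatrixMultiplication.Theorems

open Summit.MatrixMultiplication.MatrixMultiplication.Theses.AutomaticSTPPDesigns
open Literature.Combinatorics.Additive

/-! ## The item -/

/-- **`SmallScalesSuffice`** (route `AutomaticSTPPDesigns`, stmt-MatrixMultiplication-7360): for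
DFAs `MA, MB, MC` over `ι × Fin p` (`p ≥ 2`) with state sets `σA, σB, σC`, if the digit-block family
they induce in `ZMod (p ^ k)` is an additive STPP family for every `k ≤ 14 (|σA| |σB| |σC|)²`, then
it is one for every `k`. (Pumping down: the violations of either clause are read by a finite-state
device with `10 (|σA| |σB| |σC|)²` live states — six DFA runs, a carry in `[-2, 2]`, one flag.)
[folklore] -/
theorem smallScalesSuffice_proof :
    Summit.MatrixMultiplication.MatrixMultiplication.Theses.AutomaticSTPPDesigns.SmallScalesSuffice := by
  intro p ι σA σB σC _ _ _ MA MB MC hp blk hsmall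
  -- membership in a block
  have hmem : ∀ (k : ℕ) {σ : Type} (M : DFA (ι × Fin p) σ) (w : Fin k → ι) (z : ZMod (p ^ k)),
      z ∈ blk k M.accepts w ↔ ∃ a : Fin k → Fin p, List.ofFn (fun j => (w j, a j)) ∈ M.accepts ∧
        ((∑ j : Fin k, (a j : ℕ) * p ^ (j : ℕ) : ℕ) : ZMod (p ^ k)) = z := by
    intro k σ M w z
    simp only [blk, Finset.mem_image, Finset.mem_filter, Finset.mem_univ, true_and]
  -- the six-run state function and the signed digit sum on lists of letters
  set q : List ((ι × ι × ι) × ((Fin p × Fin p) × (Fin p × Fin p) × (Fin p × Fin p))) →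
      σA × σA × σB × σB × σC × σC := fun l =>
    (MA.eval (List.map (fun x => (x.1.1, x.2.1.1)) l),
      MA.eval (List.map (fun x => (x.1.2.1, x.2.1.2)) l),
      MB.eval (List.map (fun x => (x.1.2.1, x.2.2.1.1)) l),
      MB.eval (List.map (fun x => (x.1.2.2, x.2.2.1.2)) l),
      MC.eval (List.map (fun x => (x.1.2.2, x.2.2.2.1)) l),
      MC.eval (List.map (fun x => (x.1.1, x.2.2.2.2)) l)) with hqdef
  have hq : ∀ l₁ l₁' l₂, q l₁ = q l₁' → q (l₁ ++ l₂) = q (l₁' ++ l₂) := by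
    intro l₁ l₁' l₂ h
    simp only [hqdef, Prod.mk.injEq, DFA.eval, List.map_append, DFA.evalFrom_of_append] at h ⊢
    obtain ⟨h0, h1, h2, h3, h4, h5⟩ := h
    rw [h0, h1, h2, h3, h4, h5]
    exact ⟨rfl, rfl, rfl, rfl, rfl, rfl⟩
  set S : List ((ι × ι × ι) × ((Fin p × Fin p) × (Fin p × Fin p) × (Fin p × Fin p))) → ℤ :=
    fun l => ((Nat.ofDigits p (List.map (fun x => (x.2.1.1 : ℕ)) l) : ℕ) : ℤ)
          - ((Nat.ofDigits p (List.map (fun x => (x.2.1.2 : ℕ)) l) : ℕ) : ℤ)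
          + ((Nat.ofDigits p (List.map (fun x => (x.2.2.1.1 : ℕ)) l) : ℕ) : ℤ)
          - ((Nat.ofDigits p (List.map (fun x => (x.2.2.1.2 : ℕ)) l) : ℕ) : ℤ)
          + ((Nat.ofDigits p (List.map (fun x => (x.2.2.2.1 : ℕ)) l) : ℕ) : ℤ)
          - ((Nat.ofDigits p (List.map (fun x => (x.2.2.2.2 : ℕ)) l) : ℕ) : ℤ) with hSdef
  have hD : ∀ (d : (ι × ι × ι) × ((Fin p × Fin p) × (Fin p × Fin p) × (Fin p × Fin p)) → ℕ)
      (l₁ l₂ : List ((ι × ι × ι) × ((Fin p × Fin p) × (Fin p × Fin p) × (Fin p × Fin p)))),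
      ((Nat.ofDigits p (List.map d (l₁ ++ l₂)) : ℕ) : ℤ) =
        (Nat.ofDigits p (List.map d l₁) : ℕ) +
          (p : ℤ) ^ l₁.length * (Nat.ofDigits p (List.map d l₂) : ℕ) := by
    intro d l₁ l₂
    rw [List.map_append, Nat.ofDigits_append, List.length_map]
    push_cast
    ring
  have hS : ∀ l₁ l₂, S (l₁ ++ l₂) = S l₁ + (p : ℤ) ^ l₁.length * S l₂ := by
    intro l₁ l₂
    simp only [hSdef, hD]
    ring
  have hDb : ∀ (d : (ι × ι × ι) × ((Fin p × Fin p) × (Fin p × Fin p) × (Fin p × Fin p)) → Fin p)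
      (l : List ((ι × ι × ι) × ((Fin p × Fin p) × (Fin p × Fin p) × (Fin p × Fin p)))),
      ((Nat.ofDigits p (List.map (fun x => (d x : ℕ)) l) : ℕ) : ℤ) < (p : ℤ) ^ l.length := by
    intro d l
    have h := Nat.ofDigits_lt_base_pow_length (b := p) (l := List.map (fun x => (d x : ℕ)) l)
      (by omega) (fun x hx => by
        obtain ⟨y, _, rfl⟩ := List.mem_map.mp hx
        exact (d y).isLt)
    rw [List.length_map] at h
    exact_mod_cast h
  have hSb : ∀ l, |S l| < 3 * (p : ℤ) ^ l.length := by
    intro l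
    have h0 : ((Nat.ofDigits p (List.map (fun x => (x.2.1.1 : ℕ)) l) : ℕ) : ℤ) <
        (p : ℤ) ^ l.length :=
      hDb (fun x => x.2.1.1) l
    have h1 : ((Nat.ofDigits p (List.map (fun x => (x.2.1.2 : ℕ)) l) : ℕ) : ℤ) <
        (p : ℤ) ^ l.length :=
      hDb (fun x => x.2.1.2) l
    have h2 : ((Nat.ofDigits p (List.map (fun x => (x.2.2.1.1 : ℕ)) l) : ℕ) : ℤ) <
        (p : ℤ) ^ l.length :=
      hDb (fun x => x.2.2.1.1) l
    have h3 : ((Nat.ofDigits p (List.map (fun x => (x.2.2.1.2 : ℕ)) l) : ℕ) : ℤ) <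
        (p : ℤ) ^ l.length :=
      hDb (fun x => x.2.2.1.2) l
    have h4 : ((Nat.ofDigits p (List.map (fun x => (x.2.2.2.1 : ℕ)) l) : ℕ) : ℤ) <
        (p : ℤ) ^ l.length :=
      hDb (fun x => x.2.2.2.1) l
    have h5 : ((Nat.ofDigits p (List.map (fun x => (x.2.2.2.2 : ℕ)) l) : ℕ) : ℤ) <
        (p : ℤ) ^ l.length :=
      hDb (fun x => x.2.2.2.2) l
    have g0 := Int.natCast_nonneg (Nat.ofDigits p (List.map (fun x => (x.2.1.1 : ℕ)) l))
    have g1 := Int.natCast_nonneg (Nat.ofDigits p (List.map (fun x => (x.2.1.2 : ℕ)) l))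
    have g2 := Int.natCast_nonneg (Nat.ofDigits p (List.map (fun x => (x.2.2.1.1 : ℕ)) l))
    have g3 := Int.natCast_nonneg (Nat.ofDigits p (List.map (fun x => (x.2.2.1.2 : ℕ)) l))
    have g4 := Int.natCast_nonneg (Nat.ofDigits p (List.map (fun x => (x.2.2.2.1 : ℕ)) l))
    have g5 := Int.natCast_nonneg (Nat.ofDigits p (List.map (fun x => (x.2.2.2.2 : ℕ)) l))
    rw [abs_lt]
    simp only [hSdef]
    constructor <;> linarith
  have hcardQ : Fintype.card (σA × σA × σB × σB × σC × σC) =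
      (Fintype.card σA * Fintype.card σB * Fintype.card σC) ^ 2 := by
    simp only [Fintype.card_prod]
    ring
  -- strong induction on the scale
  intro k
  induction k using Nat.strong_induction_on with
  | _ k ih => ?_
  by_contra hk
  have hbig : ¬ k ≤ 14 * (Fintype.card σA * Fintype.card σB * Fintype.card σC) ^ 2 :=
    fun h => hk (hsmall k h)
  obtain ⟨l, hlen, hacc, hdiv, hbad⟩ :=
    smallScales_extract MA MB MC _ _ _ (hmem k MA) (hmem k MB) (hmem k MC) hk
  subst hlen
  have hlen10 : 10 * Fintype.card (σA × σA × σB × σB × σC × σC) ≤ l.length := by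
    rw [hcardQ]
    have := not_le.mp hbig
    generalize (Fintype.card σA * Fintype.card σB * Fintype.card σC) ^ 2 = m at this ⊢
    omega
  -- transfer of the six acceptances along `q l' = q l`
  have hacc_of : ∀ l', q l' = q l →
      (List.map (fun x => (x.1.1, x.2.1.1)) l' ∈ MA.accepts ∧
        List.map (fun x => (x.1.2.1, x.2.1.2)) l' ∈ MA.accepts ∧
        List.map (fun x => (x.1.2.1, x.2.2.1.1)) l' ∈ MB.accepts ∧
        List.map (fun x => (x.1.2.2, x.2.2.1.2)) l' ∈ MB.accepts ∧
        List.map (fun x => (x.1.2.2, x.2.2.2.1)) l' ∈ MC.accepts ∧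
        List.map (fun x => (x.1.1, x.2.2.2.2)) l' ∈ MC.accepts) := by
    intro l' hql
    simp only [hqdef, Prod.mk.injEq] at hql
    obtain ⟨e0, e1, e2, e3, e4, e5⟩ := hql
    simp only [DFA.mem_accepts] at hacc ⊢
    rw [e0, e1, e2, e3, e4, e5]
    exact hacc
  rcases hbad with hbadII | ⟨hgoodI, hbadI⟩
  · obtain ⟨l', hlt, hql, hdiv', -, hbad'⟩ := smallScales_shorten q hq p hp S hS hSb
      (fun _ => True) (fun x => x.1.1 ≠ x.1.2.1 ∨ x.1.2.1 ≠ x.1.2.2) l hlen10 hdiv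
      (fun _ _ => trivial) hbadII
    exact smallScales_realize MA MB MC l' _ _ _ (hmem _ MA) (hmem _ MB) (hmem _ MC)
      (hacc_of l' hql) hdiv' (Or.inl hbad') (ih _ hlt)
  · obtain ⟨l', hlt, hql, hdiv', hgood', hbad'⟩ := smallScales_shorten q hq p hp S hS hSb
      (fun x => x.1.1 = x.1.2.1 ∧ x.1.2.1 = x.1.2.2)
      (fun x => x.2.1.1 ≠ x.2.1.2 ∨ x.2.2.1.1 ≠ x.2.2.1.2 ∨ x.2.2.2.1 ≠ x.2.2.2.2) l hlen10 hdiv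
      hgoodI hbadI
    exact smallScales_realize MA MB MC l' _ _ _ (hmem _ MA) (hmem _ MB) (hmem _ MC)
      (hacc_of l' hql) hdiv' (Or.inr ⟨hgood', hbad'⟩) (ih _ hlt)

end Summit.MatrixMultiplication.MatrixMultiplication.Theorems
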